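import Literature.Computability.MetaComplexity.EFModMulUCommS
import HarnessLib

/-!
# Commutativity of uniform modular multiplication, part B3: the law

Layer E/6 (uniform variant). `ModMulU.Comm.isBlock_lines`: for an available occurrence of the
commutativity kit on `(a, b, n, z)` with `a, b < n` (facts about the kit's comparators), the
zero gate `z`, `m + 2 ≤ L` and the high bits of `n` false from `m` on, the lines form a block
concluding `P_L(M_L) ≡ P_L(BA)`, i.e. `a ⊗ b = b ⊗ a` bitwise for the kit's canonical
instances `M_L = a ⊗ b` and `BA = b ⊗ a`.

The induction `a ⊗ B_s ≡ B_s ⊗ a` over `s ≤ L` (`B_s = b >> (L - s)`): the base (`B_0 = 0`,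
both sides are zero by the zero law), the stages (part B2), the last stage linking to `BA`.

## Sources

* S. A. Cook, R. A. Reckhow, *The relative efficiency of propositional proof systems*,
  J. Symbolic Logic 44 (1979), §2.
* J. Krajíček, *Bounded Arithmetic, Propositional Logic, and Complexity Theory* (CUP 1995), §9.2.
-/

namespace Literature.Computability.MetaComplexity

open _root_.Computability Complexity Complexity.PropForm Netlist Cluster FregeSystem

namespace ModMulU

namespace Comm

section Defs

variable (L : ℕ) (o : Occ) (K : PropForm ℕ) (m : ℕ)

/-- The prefix: `¬z` and the shift chain of `b` (`Bw k < n` for `1 ≤ k ≤ L`). [folklore] -/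
def prefixLines : List (PropForm ℕ) :=
  [ctx K (neg (var (zv L o)))] ++ One.shUpTo L (ShB L o) K (o.base + (3 * L + 1)) L

/-- The base: `M_0`, `LD1_0`'s `VX` and `VY` are zero, hence equal. [folklore] -/
def baseSegs : List (List (PropForm ℕ)) :=
  [ModAddU.AssocKit.transferLines (CmpA L o) ((M L o 0).CA L) K L,
   ModAddU.AssocKit.transferLines (CAB L o L) (CX1 L o 0) K L,
   ModAddU.AssocKit.transferLines (CAB L o L) (CY1 L o 0) K L,
   ShiftMul.maskF L K (M L o 0) L,
   ShiftMul.maskF L K (Stage.VX1 L o 0) L,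
   ShiftMul.maskF L K (Stage.VY1 L o 0) L,
   Zero.lines (M L o 0) L K,
   Zero.lines (Stage.VX1 L o 0) L K,
   Zero.lines (Stage.VY1 L o 0) L K,
   (List.range L).map (fun i => ctx K (eqv ((M L o 0).P L L i) ((Stage.VX1 L o 0).P L L i))),
   (List.range L).map (fun i => ctx K (eqv ((M L o 0).P L L i) ((Stage.VY1 L o 0).P L L i)))]

/-- The stages `0 … s-1` (for `s ≤ L - 1`), each linking to the next `LD1`. [folklore] -/
def commUpTo : ℕ → List (PropForm ℕ)
  | 0 => (baseSegs L o K).flatten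
  | s + 1 => commUpTo s ++ (Stage.segs L o K m s (Stage.VX1 L o (s + 1)) (Stage.VY1 L o (s + 1))).flatten

/-- **The lines of the commutativity law.** [folklore] -/
def lines : List (PropForm ℕ) :=
  prefixLines L o K ++ (commUpTo L o K m (L - 1) ++ (Stage.segs L o K m (L - 1) (BA L o) (BA L o)).flatten)

end Defs

variable {L : ℕ} {o : Occ} {K : PropForm ℕ} {G : FregeSystem} {Γ : Set (PropForm ℕ)}

/-- The facts of the shift chain of `b`. [folklore] -/
theorem mem_prefix {k : ℕ} (hk : k < L) : ctx K (neg (var ((CAB L o (k + 1)).ge L L))) ∈ prefixLines L o K :=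
  List.mem_append_right _ (One.mem_shUpTo hk)

/-- `¬z` is in the prefix. [folklore] -/
theorem mem_prefix_z : ctx K (neg (var (zv L o))) ∈ prefixLines L o K := List.mem_append_left _ (List.mem_singleton_self _)

/-- **The prefix forms a block.** [cite: CookReckhow1979, §2] -/
theorem isBlock_prefix (hGY : ∀ r ∈ Sys.sysRules, r ∈ G.rules) (hGS : ∀ r ∈ Sys.glue, r ∈ G.rules) (hGL : ∀ r ∈ Logic.rules, r ∈ G.rules)
    (hL : 0 < L) (h : CAvail L o K Γ) (hzdef : ctx K (biimp (var (zv L o)) (const false)) ∈ Γ)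
    (hltB : ctx K (neg (var ((CmpB L o).ge L L))) ∈ Γ) : G.IsBlock Γ (prefixLines L o K) := by
  have hz' : G.IsBlock Γ [ctx K (neg (var (zv L o)))] := FregeSystem.IsBlock.singleton (Or.inr (Logic.infer hGL 11 (by decide)
    (FregeSystem.sub [K, var (zv L o)]) rfl (FregeSystem.prems_cons hzdef FregeSystem.prems_nil)))
  refine hz'.append ?_
  refine One.isBlock_shUpTo hGY hGS (h.hShB.mono Set.subset_union_left) ?_ (Or.inl hltB) ?_ hL L le_rfl
  · refine Sub.View.Avail.congr (h.hB.mono Set.subset_union_left) rfl (fun i hi => ?_) (fun i hi => ?_)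
    · show One.Aw L (ShB L o) 0 i = o.inp (L + i); rw [Aw_ShB, Bw_zero hi]
    · exact nw_ShB hi
  · have e : Shift.zv L (ShB L o) = zv L o := by unfold Shift.zv zv; rw [ShB_inp (by omega), if_neg (by omega)]
    rw [show One.zg L (ShB L o) = zv L o from e]; exact Or.inl hzdef

/-- Availability of the comparators of the `Bw k`. [folklore] -/
theorem avail_CAB (h : CAvail L o K Γ) : ∀ k ≤ L, (CAB L o k).Avail K Γ L := by
  intro k hk
  rcases Nat.eq_zero_or_pos k with rfl | hk0
  · refine Sub.View.Avail.congr h.hB rfl (fun i hi => ?_) (fun i hi => ?_)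
    · show One.Aw L (ShB L o) 0 i = o.inp (L + i); rw [Aw_ShB, Bw_zero hi]
    · exact nw_ShB hi
  · obtain ⟨j, rfl⟩ : ∃ j, k = j + 1 := ⟨k - 1, by omega⟩
    exact One.avail_CA_succ h.hShB (by omega)

/-- The length of the base segment list. [folklore] -/
theorem length_baseSegs (L : ℕ) (o : Occ) (K : PropForm ℕ) : (baseSegs L o K).length = 11 := rfl

/-- **The base forms a block**: `a ⊗ 0 ≡ 0 ⊗ a` (all zero). [cite: CookReckhow1979, §2] -/
theorem isBlock_base (hGK : ∀ r ∈ LD.maskRules, r ∈ G.rules) (hGS : ∀ r ∈ Sys.glue, r ∈ G.rules) (hGN : ∀ r ∈ Netlist.rules, r ∈ G.rules)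
    (hGA : ∀ r ∈ Adder.rules, r ∈ G.rules) (hGL : ∀ r ∈ Logic.rules, r ∈ G.rules) (hL : 0 < L) {T : Set (PropForm ℕ)}
    (h : CAvail L o K T) (hz : ctx K (neg (var (zv L o))) ∈ T) (hCAB : (CAB L o L).Avail K T L)
    (hltBL : ctx K (neg (var ((CAB L o L).ge L L))) ∈ T) (hltA : ctx K (neg (var ((CmpA L o).ge L L))) ∈ T) :
    G.IsBlock T (baseSegs L o K).flatten := by
  have h1 := LD.avail_ofOcc (h.hLD1 0 hL)
  have hM0 : (M L o 0).RAvail L K T := h.hM 0 (Nat.zero_le _)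
  obtain ⟨-, -, -, -, hCX1, hCY1⟩ := avail_canon hL h hL
  refine ModAddU.AssocData.isBlock_flatten _ fun k hk => ?_
  rw [length_baseSegs] at hk
  have mem : ∀ {χ} (j : ℕ) (hj : j < k) (hχ : χ ∈ (baseSegs L o K)[j]'(by rw [length_baseSegs]; omega)),
      χ ∈ T ∪ {χ | ∃ j, ∃ hj : j < k, χ ∈ (baseSegs L o K)[j]'(by rw [length_baseSegs]; omega)} := fun j hj hχ => Or.inr ⟨j, hj, hχ⟩
  have hΓ : T ⊆ T ∪ {χ | ∃ j, ∃ hj : j < k, χ ∈ (baseSegs L o K)[j]'(by rw [length_baseSegs]; omega)} := fun _ hχ => Or.inl hχ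
  have mr : ∀ {f : ℕ → PropForm ℕ} {W i : ℕ}, i < W → f i ∈ (List.range W).map f := fun hi => List.mem_map.2 ⟨_, List.mem_range.2 hi, rfl⟩
  interval_cases k
  · exact ModAddU.AssocKit.isBlock_transferLines hGN hGA hGL (h.hA.mono hΓ) (hM0.hCA.mono hΓ) (fun i hi => rfl) (fun i hi => rfl) (hΓ hltA)
  · exact ModAddU.AssocKit.isBlock_transferLines hGN hGA hGL (hCAB.mono hΓ) (hCX1.mono hΓ)
      (fun i hi => by show One.Aw L (ShB L o) L i = Bw L o (L - 0) i; rw [Nat.sub_zero]; exact Aw_ShB) (fun i hi => nw_ShB hi) (hΓ hltBL)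
  · exact ModAddU.AssocKit.isBlock_transferLines hGN hGA hGL (hCAB.mono hΓ) (hCY1.mono hΓ)
      (fun i hi => by show One.Aw L (ShB L o) L i = Bw L o (L - 0) i; rw [Nat.sub_zero]; exact Aw_ShB) (fun i hi => nw_ShB hi) (hΓ hltBL)
  · exact ShiftMul.isBlock_maskF hGL (hM0.hV.mono hΓ) le_rfl (fun t ht => by show Bw L o (L - 0) (L - 1 - t) = zv L o; rw [Nat.sub_zero, Bw_L]) (hΓ hz)
  · refine Zero.isBlock_maskF_of_word_all hGS (h1.hVX.hV.mono hΓ) fun i hi => ?_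
    show ctx K (neg (var ((LD1 L o 0).inp i))) ∈ _; rw [(LD1_inp hL hi).1, Nat.sub_zero, Bw_L]; exact hΓ hz
  · refine Zero.isBlock_maskF_of_word_all hGS (h1.hVY.hV.mono hΓ) fun i hi => ?_
    show ctx K (neg (var ((LD1 L o 0).inp (L + i)))) ∈ _; rw [(LD1_inp hL hi).2.1, Nat.sub_zero, Bw_L]; exact hΓ hz
  · exact Zero.isBlock_lines hGK hGL (hM0.hV.mono hΓ) (hM0.hCA.mono hΓ) (mem 0 (by omega) (ModAddU.AssocKit.mem_transferLines _ _ _ _))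
      fun t ht i hi => mem 3 (by omega) (ShiftMul.mem_maskF ht hi)
  · exact Zero.isBlock_lines hGK hGL (h1.hVX.hV.mono hΓ) (h1.hVX.hCA.mono hΓ) (mem 1 (by omega) (ModAddU.AssocKit.mem_transferLines _ _ _ _))
      fun t ht i hi => mem 4 (by omega) (ShiftMul.mem_maskF ht hi)
  · exact Zero.isBlock_lines hGK hGL (h1.hVY.hV.mono hΓ) (h1.hVY.hCA.mono hΓ) (mem 2 (by omega) (ModAddU.AssocKit.mem_transferLines _ _ _ _))
      fun t ht i hi => mem 5 (by omega) (ShiftMul.mem_maskF ht hi)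
  · refine Scaffold.isBlock_of_forall fun θ hθ => ?_
    obtain ⟨i, hi, rfl⟩ := List.mem_map.1 hθ
    rw [List.mem_range] at hi
    exact Or.inr (Logic.infer hGL 10 (by decide) (FregeSystem.sub [K, var ((M L o 0).P L L i), var ((Stage.VX1 L o 0).P L L i)]) rfl
      (FregeSystem.prems_cons (mem 6 (by omega) (Zero.mem_lines le_rfl hi)) (FregeSystem.prems_cons (mem 7 (by omega) (Zero.mem_lines le_rfl hi))
        FregeSystem.prems_nil)))
  · refine Scaffold.isBlock_of_forall fun θ hθ => ?_
    obtain ⟨i, hi, rfl⟩ := List.mem_map.1 hθ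
    rw [List.mem_range] at hi
    exact Or.inr (Logic.infer hGL 10 (by decide) (FregeSystem.sub [K, var ((M L o 0).P L L i), var ((Stage.VY1 L o 0).P L L i)]) rfl
      (FregeSystem.prems_cons (mem 6 (by omega) (Zero.mem_lines le_rfl hi)) (FregeSystem.prems_cons (mem 8 (by omega) (Zero.mem_lines le_rfl hi))
        FregeSystem.prems_nil)))

/-- The conclusions of the base. [folklore] -/
theorem mem_base {i : ℕ} (hi : i < L) :
    ctx K (eqv ((M L o 0).P L L i) ((Stage.VX1 L o 0).P L L i)) ∈ (baseSegs L o K).flatten ∧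
    ctx K (eqv ((M L o 0).P L L i) ((Stage.VY1 L o 0).P L L i)) ∈ (baseSegs L o K).flatten := by
  have h11 : (baseSegs L o K).length = 11 := rfl
  exact ⟨List.mem_flatten.2 ⟨_, List.getElem_mem (n := 9) (by omega), List.mem_map.2 ⟨i, List.mem_range.2 hi, rfl⟩⟩,
    List.mem_flatten.2 ⟨_, List.getElem_mem (n := 10) (by omega), List.mem_map.2 ⟨i, List.mem_range.2 hi, rfl⟩⟩⟩

/-- `commUpTo` is monotone. [folklore] -/
theorem commUpTo_mono {m s t : ℕ} (hst : s ≤ t) : ∀ χ ∈ commUpTo L o K m s, χ ∈ commUpTo L o K m t := by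
  induction hst with
  | refl => exact fun χ h => h
  | step _ ih => exact fun χ h => List.mem_append_left _ (ih χ h)

/-- The induction hypothesis after `s` stages. [folklore] -/
theorem mem_commUpTo (hL : 0 < L) {m : ℕ} : ∀ {s i : ℕ}, i < L →
    ctx K (eqv ((M L o s).P L L i) ((Stage.VX1 L o s).P L L i)) ∈ commUpTo L o K m s ∧
    ctx K (eqv ((M L o s).P L L i) ((Stage.VY1 L o s).P L L i)) ∈ commUpTo L o K m s
  | 0, _, hi => mem_base hi
  | _ + 1, _, hi => ⟨List.mem_append_right _ (Stage.mem_segs_out hL hi).1, List.mem_append_right _ (Stage.mem_segs_out hL hi).2⟩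

/-- The operands of `LD1_s`'s `VX`, `VY`. [folklore] -/
theorem VX1_ops {s i : ℕ} (hs : s < L) (hi : i < L) :
    (Stage.VX1 L o s).a i = Bw L o (L - s) i ∧ (Stage.VX1 L o s).b i = o.inp i ∧ (Stage.VX1 L o s).n i = nv L o i ∧
    (Stage.VY1 L o s).a i = Bw L o (L - s) i ∧ (Stage.VY1 L o s).b i = o.inp i ∧ (Stage.VY1 L o s).n i = nv L o i :=
  ⟨(LD1_inp hs hi).1, (LD1_inp hs hi).2.2.1, (LD1_inp hs hi).2.2.2, (LD1_inp hs hi).2.1, (LD1_inp hs hi).2.2.1, (LD1_inp hs hi).2.2.2⟩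

/-- **The stages form a block.** [cite: CookReckhow1979, §2] -/
theorem isBlock_commUpTo (hGC : ∀ r ∈ rules, r ∈ G.rules) (hGO : ∀ r ∈ One.rules, r ∈ G.rules) (hGS : ∀ r ∈ Sys.glue, r ∈ G.rules)
    (hGY : ∀ r ∈ Sys.sysRules, r ∈ G.rules) (hGN : ∀ r ∈ Netlist.rules, r ∈ G.rules) (hGA : ∀ r ∈ Adder.rules, r ∈ G.rules)
    (hGL : ∀ r ∈ Logic.rules, r ∈ G.rules) (hG : ∀ r ∈ ModAddU.assocRules, r ∈ G.rules) (hGM : ∀ r ∈ ModAddU.rules, r ∈ G.rules)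
    (hGR : ∀ r ∈ rangeRules, r ∈ G.rules) (hGG : ∀ r ∈ ModAddU.glueRules, r ∈ G.rules) (hGK : ∀ r ∈ LD.maskRules, r ∈ G.rules)
    (hL : 0 < L) {T : Set (PropForm ℕ)} (h : CAvail L o K T) {m : ℕ} (hm : m + 2 ≤ L)
    (hz : ctx K (neg (var (zv L o))) ∈ T) (hzdef : ctx K (biimp (var (zv L o)) (const false)) ∈ T)
    (hltB : ∀ k ≤ L, ctx K (neg (var ((CAB L o k).ge L L))) ∈ T) (hltA : ctx K (neg (var ((CmpA L o).ge L L))) ∈ T)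
    (hnh : ∀ i, m ≤ i → i < L → ctx K (neg (var (nv L o i))) ∈ T) : ∀ s, s + 1 ≤ L → G.IsBlock T (commUpTo L o K m s) := by
  intro s hs
  induction s with
  | zero => exact isBlock_base hGK hGS hGN hGA hGL hL h hz (avail_CAB h L le_rfl) (hltB L le_rfl) hltA
  | succ s ih =>
    have hs1 : s + 1 < L := by omega
    have h1 := LD.avail_ofOcc (h.hLD1 (s + 1) hs1)
    refine (ih (by omega)).append (Stage.isBlock_segs hGC hGO hGS hGY hGN hGA hGL hG hGM hGR hGG hGK hL
      (by exact ⟨h.hA.mono Set.subset_union_left, h.hB.mono Set.subset_union_left, h.hShB.mono Set.subset_union_left,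
        h.hOneA.mono Set.subset_union_left, fun s hs => (h.hM s hs).mono Set.subset_union_left,
        fun s hs => (h.hLD1 s hs).mono Set.subset_union_left, fun s hs => (h.hLD2 s hs).mono Set.subset_union_left,
        h.hBA.mono Set.subset_union_left⟩) hm (by omega)
      (h1.hVX.hV.mono Set.subset_union_left) (h1.hVY.hV.mono Set.subset_union_left)
      (fun i hi => (VX1_ops hs1 hi).1) (fun i hi => (VX1_ops hs1 hi).2.1) (fun i hi => (VX1_ops hs1 hi).2.2.1)
      (fun i hi => (VX1_ops hs1 hi).2.2.2.1) (fun i hi => (VX1_ops hs1 hi).2.2.2.2.1) (fun i hi => (VX1_ops hs1 hi).2.2.2.2.2)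
      (Or.inl hz) (Or.inl hzdef) (fun k hk => (avail_CAB h k hk).mono Set.subset_union_left) (fun k hk => Or.inl (hltB k hk))
      (Or.inl hltA) (fun i h₁ h₂ => Or.inl (hnh i h₁ h₂)) (fun i hi => Or.inr (mem_commUpTo hL hi).1) fun i hi => Or.inr (mem_commUpTo hL hi).2)

/-- **Commutativity of modular multiplication inside Frege**: for an available occurrence of the
commutativity kit with `a, b < n` (facts about the kit's comparators), the zero gate `z`
(`z ↔ ⊥`), `m + 2 ≤ L` and the high bits of `n` false from `m` on, the lines form a block
concluding `P_L(M_L) ≡ P_L(BA)`: `a ⊗ b = b ⊗ a` bitwise. [cite: CookReckhow1979, §2; Krajicek1995, §9.2] -/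
theorem isBlock_lines (hGC : ∀ r ∈ rules, r ∈ G.rules) (hGO : ∀ r ∈ One.rules, r ∈ G.rules) (hGS : ∀ r ∈ Sys.glue, r ∈ G.rules)
    (hGY : ∀ r ∈ Sys.sysRules, r ∈ G.rules) (hGN : ∀ r ∈ Netlist.rules, r ∈ G.rules) (hGA : ∀ r ∈ Adder.rules, r ∈ G.rules)
    (hGL : ∀ r ∈ Logic.rules, r ∈ G.rules) (hG : ∀ r ∈ ModAddU.assocRules, r ∈ G.rules) (hGM : ∀ r ∈ ModAddU.rules, r ∈ G.rules)
    (hGR : ∀ r ∈ rangeRules, r ∈ G.rules) (hGG : ∀ r ∈ ModAddU.glueRules, r ∈ G.rules) (hGK : ∀ r ∈ LD.maskRules, r ∈ G.rules)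
    (hL : 0 < L) (h : CAvail L o K Γ) {m : ℕ} (hm : m + 2 ≤ L) (hzdef : ctx K (biimp (var (zv L o)) (const false)) ∈ Γ)
    (hltA : ctx K (neg (var ((CmpA L o).ge L L))) ∈ Γ) (hltB : ctx K (neg (var ((CmpB L o).ge L L))) ∈ Γ)
    (hnh : ∀ i, m ≤ i → i < L → ctx K (neg (var (nv L o i))) ∈ Γ) : G.IsBlock Γ (lines L o K m) := by
  have s1 : ∀ {A B : Set (PropForm ℕ)}, A ⊆ A ∪ B := fun {_ _} => Set.subset_union_left
  have hltB' : ∀ {T}, Γ ∪ {χ | χ ∈ prefixLines L o K} ⊆ T → ∀ k ≤ L, ctx K (neg (var ((CAB L o k).ge L L))) ∈ T := by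
    intro T hT k hk
    rcases Nat.eq_zero_or_pos k with rfl | hk0
    · exact hT (Or.inl hltB)
    · obtain ⟨j, rfl⟩ : ∃ j, k = j + 1 := ⟨k - 1, by omega⟩
      exact hT (Or.inr (mem_prefix (by omega)))
  have hC : ∀ {T}, Γ ⊆ T → CAvail L o K T := fun hT =>
    ⟨h.hA.mono hT, h.hB.mono hT, h.hShB.mono hT, h.hOneA.mono hT, fun s hs => (h.hM s hs).mono hT, fun s hs => (h.hLD1 s hs).mono hT,
      fun s hs => (h.hLD2 s hs).mono hT, h.hBA.mono hT⟩
  refine (isBlock_prefix hGY hGS hGL hL h hzdef hltB).append ((isBlock_commUpTo hGC hGO hGS hGY hGN hGA hGL hG hGM hGR hGG hGK hL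
    (hC s1) hm (Or.inr mem_prefix_z) (s1 hzdef) (hltB' le_rfl) (s1 hltA) (fun i h₁ h₂ => s1 (hnh i h₁ h₂)) (L - 1) (by omega)).append ?_)
  refine Stage.isBlock_segs hGC hGO hGS hGY hGN hGA hGL hG hGM hGR hGG hGK hL (hC (s1.trans s1)) hm (by omega)
    ((h.hBA.hV.mono s1).mono s1) ((h.hBA.hV.mono s1).mono s1) (fun i hi => ?_) (fun i hi => rfl) (fun i hi => rfl)
    (fun i hi => ?_) (fun i hi => rfl) (fun i hi => rfl) (s1 (Or.inr mem_prefix_z)) (s1 (s1 hzdef)) (fun k hk => (avail_CAB (hC (s1.trans s1)) k hk))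
    (hltB' s1) (s1 (s1 hltA)) (fun i h₁ h₂ => s1 (s1 (hnh i h₁ h₂))) (fun i hi => Or.inr (mem_commUpTo hL hi).1)
    fun i hi => Or.inr (mem_commUpTo hL hi).2
  · show o.inp (L + i) = Bw L o (L - (L - 1) - 1) i; rw [show L - (L - 1) - 1 = 0 by omega, Bw_zero hi]
  · show o.inp (L + i) = Bw L o (L - (L - 1) - 1) i; rw [show L - (L - 1) - 1 = 0 by omega, Bw_zero hi]

/-- **The conclusion of the commutativity law**: `P_L(M_L)ᵢ ↔ P_L(BA)ᵢ`. [folklore] -/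
theorem mem_lines (hL : 0 < L) {m i : ℕ} (hi : i < L) : ctx K (eqv ((M L o L).P L L i) ((BA L o).P L L i)) ∈ lines L o K m := by
  have := (Stage.mem_segs_out (L := L) (o := o) (K := K) (m := m) (s := L - 1) (N := BA L o) (N' := BA L o) hL hi).1
  rw [Nat.sub_add_cancel hL] at this
  exact List.mem_append_right _ (List.mem_append_right _ this)

/-! ### The size of the law -/

/-- Size of a transitivity or symmetry segment. [folklore] -/
theorem proofSize_mapEqv (K : PropForm ℕ) (u w : ℕ → ℕ) (L : ℕ) :
    proofSize ((List.range L).map fun i => ctx K (eqv (u i) (w i))) ≤ L * (K.size + 10) := by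
  refine ((ModAddU.bounded_ctx_eqv K le_rfl _ _ _).proofSize_le).trans ?_; simp

/-- **Size of a stage**: `≤ 24200 (L+1)² (|K| + 153)`. [folklore] -/
theorem proofSize_stage (hL : 0 < L) (o : Occ) (K : PropForm ℕ) (m : ℕ) (s : ℕ) (N N' : View) :
    proofSize (Stage.segs L o K m s N N').flatten ≤ 24200 * ((L + 1) * (L + 1)) * (K.size + 153) := by
  have hF := proofSize_segs L o K s
  have hL1 := LD.proofSize_lines L (LD1 L o s) K m
  have hL2 := LD.proofSize_lines L (LD2 L o s) K m
  have hO := One.proofSize_lines (L := L) (OneA L o) K (Stage.VY2 L o s) (Stage.cbit L o s) o.base hL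
  have hS := ShiftMul.proofSize_lines (L := L) (K := K) (V := M L o s) (V' := Stage.M' L o s) (k := L - s) (zv L o) (Nat.sub_le L s)
  have hR : proofSize (Adder.reflLines K ((List.range L).map (av o) ++ (List.range L).map (nv L o) ++ (List.range L).map (R1 L o s))) =
      3 * L * (K.size + 10) := by rw [Adder.proofSize_reflLines]; simp; ring
  have hT := fun (u w : ℕ → ℕ) => proofSize_mapEqv K u w L
  have hP1 := (⟨(Stage.M' L o s).Dv L (L - 1), Stage.RL1 L o s, L⟩ : ModAddU.PairData).proofSize_leibLines (K := K)
  have hP2 := (⟨(Stage.M' L o s).Av L (L - 1), Stage.RL2 L o s, L⟩ : ModAddU.PairData).proofSize_leibLines (K := K)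
  have hQ1 := (⟨Stage.VS1 L o s, Stage.VX2 L o s, L⟩ : PairData).proofSize_lines (K := K)
  have hQ2 := (⟨Stage.VS2 L o s, N, L⟩ : PairData).proofSize_lines (K := K)
  have hQ3 := (⟨Stage.VS2 L o s, N', L⟩ : PairData).proofSize_lines (K := K)
  dsimp only at hP1 hP2 hQ1 hQ2 hQ3
  simp only [Stage.segs, List.flatten_cons, List.flatten_nil, proofSize_append, List.append_nil]
  unfold ModAddU.MFI.transLines ModAddU.MFI.symmLines
  nlinarith [hF, hL1, hL2, hO, hS, hR, hT ((Stage.M' L o s).P L (L - 1)) ((Stage.VX1 L o s).P L L),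
    hT ((Stage.M' L o s).P L (L - 1)) ((Stage.VY1 L o s).P L L),
    hT (fun i => (Stage.RL1 L o s).R L i) (fun i => (Stage.VS1 L o s).P L L i),
    hT (((Stage.M' L o s).Dv L (L - 1)).R L) ((Stage.VS1 L o s).P L L),
    hT (((Stage.M' L o s).Dv L (L - 1)).R L) ((Stage.VX2 L o s).P L L),
    hT ((Stage.M' L o s).msk L (L - 1)) ((Stage.VY2 L o s).P L L),
    hT (fun i => (Stage.RL2 L o s).R L i) (fun i => (Stage.VS2 L o s).P L L i),
    hT (((Stage.M' L o s).Av L (L - 1)).R L) ((Stage.VS2 L o s).P L L),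
    hT (((Stage.M' L o s).Av L (L - 1)).R L) (N.P L L), hT (((Stage.M' L o s).Av L (L - 1)).R L) (N'.P L L),
    hP1, hP2, hQ1, hQ2, hQ3, Nat.zero_le K.size, Nat.zero_le L]

/-- Size of the base. [folklore] -/
theorem proofSize_base (o : Occ) (K : PropForm ℕ) : proofSize (baseSegs L o K).flatten ≤ 60 * ((L + 1) * (L + 1)) * (K.size + 153) := by
  have hm : ∀ (W : View), proofSize (ShiftMul.maskF L K W L) ≤ L * L * (K.size + 3) := by
    intro W
    refine (ModAddU.Bounded.proofSize_le (B := K.size + 3) fun θ hθ => ?_).trans ?_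
    · obtain ⟨l, hl, hθ⟩ := List.mem_flatten.1 hθ
      obtain ⟨t, -, rfl⟩ := List.mem_map.1 hl
      obtain ⟨i, -, rfl⟩ := List.mem_map.1 hθ
      rw [ModAddU.size_ctx]; simp [size]
    · apply Nat.mul_le_mul_right
      simp only [ShiftMul.maskF, List.length_flatten, List.map_map]
      rw [show (List.map (List.length ∘ fun t => List.map (fun i => ctx K (neg (var (W.msk L t i)))) (List.range L)) (List.range L)) =
        (List.range L).map (fun _ => L) from List.map_congr_left fun t _ => by simp]
      simp [List.sum_replicate]
  have hz := fun (W : View) => Zero.proofSize_lines (V := W) (L := L) (K := K)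
  have ht := fun (A B : Sub.View) => ModAddU.AssocKit.proofSize_transferLines A B K L
  have he := fun (u w : ℕ → ℕ) => proofSize_mapEqv K u w L
  simp only [baseSegs, List.flatten_cons, List.flatten_nil, proofSize_append, List.append_nil]
  nlinarith [hm (M L o 0), hm (Stage.VX1 L o 0), hm (Stage.VY1 L o 0), hz (M L o 0), hz (Stage.VX1 L o 0), hz (Stage.VY1 L o 0),
    ht (CmpA L o) ((M L o 0).CA L), ht (CAB L o L) (CX1 L o 0), ht (CAB L o L) (CY1 L o 0),
    he ((M L o 0).P L L) ((Stage.VX1 L o 0).P L L), he ((M L o 0).P L L) ((Stage.VY1 L o 0).P L L), Nat.zero_le K.size, Nat.zero_le L]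

/-- **Size of the commutativity law**: `≤ 24300 (L+1)³ (|K| + 153)`. [folklore] -/
theorem proofSize_lines (hL : 0 < L) (o : Occ) (K : PropForm ℕ) (m : ℕ) :
    proofSize (lines L o K m) ≤ 24300 * ((L + 1) * (L + 1) * (L + 1)) * (K.size + 153) := by
  have hp : proofSize (prefixLines L o K) ≤ (K.size + 12) + L * ((3 * L + 3) * (K.size + 100)) := by
    rw [prefixLines, proofSize_append]
    refine Nat.add_le_add ?_ ?_
    · refine (ModAddU.Bounded.proofSize_le (B := K.size + 12) (ModAddU.Bounded.singleton ?_)).trans (by simp)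
      rw [ModAddU.size_ctx]; simp [size]
    · suffices h : ∀ t, proofSize (One.shUpTo L (ShB L o) K (o.base + (3 * L + 1)) t) ≤ t * ((3 * L + 3) * (K.size + 100)) from h L
      intro t
      induction t with
      | zero => simp [One.shUpTo]
      | succ t ih =>
        rw [One.shUpTo, proofSize_append]
        calc _ ≤ t * ((3 * L + 3) * (K.size + 100)) + (3 * L + 3) * (K.size + 100) := Nat.add_le_add ih (Shift.proofSize_lines _)
          _ = _ := by ring
  have hu : ∀ s, proofSize (commUpTo L o K m s) ≤ 60 * ((L + 1) * (L + 1)) * (K.size + 153) + s * (24200 * ((L + 1) * (L + 1)) * (K.size + 153)) := by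
    intro s
    induction s with
    | zero => rw [commUpTo, Nat.zero_mul, Nat.add_zero]; exact proofSize_base o K
    | succ s ih =>
      rw [commUpTo, proofSize_append]
      calc _ ≤ 60 * ((L + 1) * (L + 1)) * (K.size + 153) + s * (24200 * ((L + 1) * (L + 1)) * (K.size + 153)) +
          24200 * ((L + 1) * (L + 1)) * (K.size + 153) := Nat.add_le_add ih (proofSize_stage hL o K m s _ _)
        _ = _ := by ring
  rw [lines, proofSize_append, proofSize_append]
  have h3 := proofSize_stage hL o K m (L - 1) (BA L o) (BA L o)
  have h2 := hu (L - 1)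
  have hL' : L - 1 ≤ L := Nat.sub_le L 1
  nlinarith [hp, h2, h3, Nat.zero_le K.size, Nat.zero_le L, Nat.mul_le_mul_right (24200 * ((L + 1) * (L + 1)) * (K.size + 153)) hL']

/-- **The commutativity law in compositional form.** [cite: CookReckhow1979, §2; Krajicek1995, §9.2] -/
theorem yields (hGC : ∀ r ∈ rules, r ∈ G.rules) (hGO : ∀ r ∈ One.rules, r ∈ G.rules) (hGS : ∀ r ∈ Sys.glue, r ∈ G.rules)
    (hGY : ∀ r ∈ Sys.sysRules, r ∈ G.rules) (hGN : ∀ r ∈ Netlist.rules, r ∈ G.rules) (hGA : ∀ r ∈ Adder.rules, r ∈ G.rules)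
    (hGL : ∀ r ∈ Logic.rules, r ∈ G.rules) (hG : ∀ r ∈ ModAddU.assocRules, r ∈ G.rules) (hGM : ∀ r ∈ ModAddU.rules, r ∈ G.rules)
    (hGR : ∀ r ∈ rangeRules, r ∈ G.rules) (hGG : ∀ r ∈ ModAddU.glueRules, r ∈ G.rules) (hGK : ∀ r ∈ LD.maskRules, r ∈ G.rules)
    (hL : 0 < L) (h : CAvail L o K Γ) {m : ℕ} (hm : m + 2 ≤ L) (hzdef : ctx K (biimp (var (zv L o)) (const false)) ∈ Γ)
    (hltA : ctx K (neg (var ((CmpA L o).ge L L))) ∈ Γ) (hltB : ctx K (neg (var ((CmpB L o).ge L L))) ∈ Γ)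
    (hnh : ∀ i, m ≤ i → i < L → ctx K (neg (var (nv L o i))) ∈ Γ) :
    G.Yields Γ (ctxSet K (eqW ((M L o L).P L L) ((BA L o).P L L) L)) (24300 * ((L + 1) * (L + 1) * (L + 1)) * (K.size + 153)) := by
  refine Yields.of_isBlock (isBlock_lines hGC hGO hGS hGY hGN hGA hGL hG hGM hGR hGG hGK hL h hm hzdef hltA hltB hnh) ?_
    (proofSize_lines hL o K m)
  rintro θ ⟨Lb, hLb, rfl⟩
  obtain ⟨i, hi, rfl⟩ := List.mem_map.1 hLb
  exact mem_lines hL (List.mem_range.1 hi)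

end Comm

end ModMulU

end Literature.Computability.MetaComplexity
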